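import Mathlib
import HarnessLib
import HarnessLib.Audit
import Summits.ResolutionOfSingularities.Statement
import HarnessLib.Audit.Status.Attr

/-!
Route: JacobianBudget

# Route JacobianBudget — burn the Jacobian budget — μ = τ/p drops by Δ_n(p) at every isolated
multiplicity-p point blow-up

It suffices to show X = IsolatedJacobianDrop together with the steering chain shared VERBATIM with
routes FrobeniusClosing / WildCones
(Steer stmt-16345, TorsorToLurelPerfect stmt-16162, PatchingRelPerfect stmt-16161,
DescentPerfectToAll stmt-0549; target IsolatedForcedTermination
stmt-16343). IsolatedJacobianDrop (crux 2, the DUAL-FEASIBLE BUDGET; lens dual-witness Stage 3):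
along the point-blow-up dynamics of a height-one
atom z^p = a(u_1..u_n) over a perfect field (the typed coefficient calculus of FrobeniusClosing,
verbatim), whenever two consecutive states are
ISOLATED of multiplicity p, the Jacobian colength μ(a) = dim κ[[u]]/(∂a) (= Tjurina number of the
atom / p, an analytic invariant) drops by AT
LEAST the universal constant Δ_n(p) = ((p−1)^n (p+1) − (−1)^n)/p ≥ 1 (Δ_1(p) = p, Δ_2(3) = 5, Δ_3(3)
= 11, Δ_4(3) = 21, Δ_3(5) = 77). The support
JacobianDropToTermination (weak duality: an ℕ-valued budget that drops forbids infinite isolated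
runs) turns it into the shared target, and the
shared chain turns the target into the Statement. Card realised: chern-budget (its LOCAL face: the
global Chern number deg c_n(Ω¹⊗M) read as a
sum of local Jacobian colengths; the card's log version is shown vacuous for p ≥ 3 and replaced by
the plain budget, see Why this line).
Lean: `IsolatedJacobianDrop ∧ JacobianDropToTermination ∧ Steer ∧ TorsorToLurelPerfect ∧
PatchingRelPerfect ∧ DescentPerfectToAll`

## Assembly
Pure logic, certified sorry-free in Sketch.lean / glue.lean (`closes`, axioms propext ·
Classical.choice · Quot.sound): fix p prime; JacobianDropToTermination applied to
IsolatedJacobianDrop gives IsolatedForcedTermination; Steer turns it into TorsorLUPerfect's body;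
TorsorToLurelPerfect gives relative LU over perfect k, PatchingRelPerfect resolution over perfect k,
DescentPerfectToAll ResolutionInChar p; the summit is ∀ p, p.Prime → ResolutionInChar p by
definition: `closes hA hB hS hT hP hD := fun p hp => hD p hp (hP p hp (hT p hp (hS (hB hA) p hp)))`.

Rationale: WHY THIS LINE. MECHANISM = a conservation law plus a no-excess lemma. (5) CONSERVATION: algebraise
and compactify the germ (finite determinacy, arXiv:1005.4503),
read ω = ds as a section of Ω¹_Y ⊗ M; under the blow-up π of a multiplicity-p point, ω' = π*ω/e^p =
d(a') is a section of Ω¹_Y' ⊗ (π*M − pE) and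
c_n drops by exactly Δ_n(p) (c(Ω_Bl) = π*c(Ω)(1+E)^n(1−E), E^n = (−1)^(n−1); Fulton Ch. 14–15 /
Eisenbud–Harris; the card's computation,
re-derived by the planner), so μ_P − Δ_n(p) = Σ over the zeros of d(a') on E of their local lengths
+ excess contributions. (4) NO EXCESS: an
isolated multiplicity-p successor Q forces the cleaned tangent form F to be ADDITIVE in the
direction of Q (F ≡ F₀(u_1..u_(n−1)) mod p-th powers —
the L(a_p) of route WildCones) and the degree-(p+1) form to have u_n-degree ≤ 2; then supp(Z(da') ∩
E) = P(Crit F) ∩ {G = 0} is a cone with vertex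
Q, every component of dimension ≥ 2 would make Q non-isolated (Krull at the vertex), so along
ISOLATED transitions Z(da') ∩ E is finite and the
law gives μ_Q ≤ μ_P − Δ_n(p) outright. Imported: enumerative geometry of twisted 1-forms
(Rudakov–Shafarevich doi:10.1070/im1976v010n06abeh001833,
Ekedahl doi:10.1007/bf02699128; the surface-foliation Milnor budget of Seidenberg
doi:10.2307/2373435 / van den Essen doi:10.1007/bfb0062814 is the
n = 2, twist-ν ancestor) into the char-p point game. What no listed route does: FrobeniusClosing
treats μ only as a boundedness HYPOTHESIS
(BoundedMilnor stmt-16346, 'μ is not known to be monotone') and needs a closing lemma; WildCones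
argues cone geometry run by run; ShadowGame
synthesises rankings (arXiv:2602.06553 evolves them by ML); here the ranking is one intrinsic
integer with a closed-form decrement, and the lens's
census (kit j022217 pending; local pre-census: 415 certified transitions, (p,n) up to (3,4) and
(5,2), translations over GF(p) and GF(p²)) measured slack μ_P − μ_Q − Δ_n(p) ≥ 0 on every certified
transition, = 0 in 93 of them.

RANKED CRUXES. #0 IsolatedForcedTermination (target) — the shared TARGET (stmt-16343 verbatim): no
start series, chart sequence and translation sequence over a perfect field of char p yields an
infinite run of the point-blow-up dynamics all of whose states are isolated of multiplicity p.
Derived in `closes` as JacobianDropToTermination applied to IsolatedJacobianDrop; consumed by Steer.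
(why it might fail: an isolated forced cycle or a μ-pumping eternal isolated chain (Hauser–Perlega's
missing forced examples) refutes it; IsolatedJacobianDrop says neither exists.) [arXiv:1802.05010,
arXiv:1412.0868, arXiv:1005.4503]
#2 IsolatedJacobianDrop (crux) — THE BUDGET (card chern-budget, local face; lens DualFeasible). For
every prime p, n ≥ 1, perfect κ of char p, every start c₀, chart sequence i and translation sequence
t: if the states at stages m and m+1 of the dynamics are both isolated (κ[[u]]/(∂a) finite) of
multiplicity p (cleaned order ≥ p), then μ(stage m+1) + Δ_n(p) ≤ μ(stage m), with μ = finrank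
κ[[u]]/(∂_1 a,…,∂_n a) of the cleaned state and Δ_n(p) = ((p−1)^n(p+1) + 1 − 2·((n+1) mod 2))/p.
Proof plan: conservation (5) + no-excess (4) of § Why this line; n = 1 is ord-bookkeeping (drop = p
= Δ_1), n = 2 includes transitions from cleaned order p+1 (no divisorial zero of the plain form;
census: drops 5,6 ≥ Δ_2(3) = 5). [difficulty: L] (why it might fail: the sharp constant may be off
where the census is thin (p = 2, n even: observed minimum drop 2 > Δ_4(2) = 1 is fine, an OVERcount
anywhere is fatal); the no-excess step uses Krull at the cone vertex and G(e_n) = 0 — one certified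
transition with μ_Q + Δ_n(p) > μ_P kills it.) [doi:10.1007/bfb0062814,
doi:10.1070/im1976v010n06abeh001833, arXiv:1802.05010, arXiv:1005.4503, arXiv:2602.06553]
#4 Steer (crux) — STEERING (stmt-16345 verbatim, shared with FrobeniusClosing/WildCones):
IsolatedForcedTermination ⇒ α_p-torsors over bases regular at the centre are uniformizable along
every valuation over every perfect field (unforced stages admit positive-dimensional permissible
centres that return the run to the isolated regime or drop multiplicity). [deps:
IsolatedJacobianDrop] [difficulty: open-problem] (why it might fail: the unforced regime may carry
the whole difficulty (CossartPiltant2019 Rem 3.2: ω rises under a permissible centre in dim 4;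
Hauser–Perlega cycles are unforced): then forced termination buys nothing and Steer is
LuAlphaPTorsor again.) [arXiv:1412.0868, arXiv:1802.05010, CutkoskyMourtada2019,
NovacoskiSpivakovsky2014, Temkin2013,
Literature.Barriers.ResolutionOfSingularities.DimensionFourFrontier]
#5 TorsorToLurelPerfect (crux) — Temkin's inseparable reduction over PERFECT ground fields
(stmt-16162 verbatim): LU of α_p-torsors over bases regular at the centre implies relative LU for
every valuation of every finitely generated K/k, k perfect of char p. [deps: Steer] [difficulty: L]
(why it might fail: rests on Temkin2013 Thm 1.3.2 (vendored fact with an unproved leaf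
Temkin2013RelativeCurveSmoothFibre) and on Temkin's model dominating the GIVEN R (relative form);
smooth ≠ regular bookkeeping at each tower step.) [Temkin2013, arXiv:0804.1554,
Literature.AlgebraicGeometry.Resolution.Temkin2013Relative,
Literature.Barriers.ResolutionOfSingularities.InseparableBaseChange]
#6 PatchingRelPerfect (crux) — Zariski patching over PERFECT ground fields (stmt-16161 verbatim):
relative local uniformization for all valuations ⇒ weak resolution of every reduced separated
finite-type scheme over the perfect field. [deps: TorsorToLurelPerfect] [difficulty: open-problem]
(why it might fail: patching LUs into one proper regular model is known only in dim ≤ 3 (Zariski;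
CossartPiltant2008 Prop 4.9 / Piltant2013 need embedded resolution one dimension down); in dim ≥ 4
no reduction Res ⇐ LU exists even in char 0 (CutkoskyMourtada2019 p.3).) [CutkoskyMourtada2019,
Temkin2013, CossartPiltant2019, NovacoskiSpivakovsky2014,
Literature.Barriers.ResolutionOfSingularities.DimensionFourFrontier]
#7 DescentPerfectToAll (crux) — PERFECT TO ALL (stmt-0549 verbatim, shared with Descent and ten
other routes): resolution of all reduced separated finite-type schemes over all perfect fields of
char p implies ResolutionInChar p. [deps: PatchingRelPerfect] [difficulty: L] (why it might fail:
the only known mechanism spreads X over a finitely generated field of definition and base-changes a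
resolution over a perfect subfield back; regular is not geometrically regular under inseparable
extension (EGA IV 6.7.4), e.g. k = F_p((t)) (Temkin2008 Question 3.3.3 open).) [arXiv:math/0703678,
Kollar2007, Literature.Barriers.ResolutionOfSingularities.InseparableBaseChange,
Literature.Barriers.ResolutionOfSingularities.RegularNotGeometricallyRegular]
#9 JacobianDropToTermination (support) — WEAK DUALITY (lens crux #2, provable now):
IsolatedJacobianDrop → IsolatedForcedTermination — along an infinite run with all states isolated of
multiplicity p the ℕ-valued μ would drop by Δ_n(p) ≥ 1 at every stage, impossible. Pure order
bookkeeping through the let-bound `run`/`mu` (run (m+1) = step (i m) (t m) (run m) definitionally).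
[difficulty: provable-now] [arXiv:1802.05010, doi:10.1007/bfb0062814]

TWO-LAYER PLAN. IsolatedJacobianDrop ⇐ SingleStepDrop (one blow-up: Isol∧MultP at c and at step i τ
c ⇒ mu(step i τ c) + Δ ≤ mu c; bc/IsolatedJacobianDrop_birth.lean stub) → glue by run (m+1) = step
(i m) (t m) (run m). SingleStepDrop ⇐ NoExcess (isolated successor ⇒ the zero scheme of d(a') on the
exceptional divisor is finite; the cone/Krull argument (4)) → Conservation (finite exceptional zero
scheme ⇒ Σ_Q length_Q = μ_P − Δ_n(p); the Chern computation (5), or a direct local-algebra count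
through the chart maps) → SingleStepDrop. Typing NoExcess/Conservation needs the exceptional zero
scheme as a κ̄-point set in the coefficient calculus — deferred to the first prover's reshaped
skeleton.

KILL CRITERIA. (i) ONE certified transition (both states isolated of multiplicity p, stabilised
colengths) with μ_Q + Δ_n(p) > μ_P refutes IsolatedJacobianDrop: if μ still drops strictly, REPAIR
by restating with the measured constant (new item IsolatedJacobianDropR, class misstated); if μ does
NOT drop (a pumping isolated step), close `refuted:IsolatedJacobianDrop` and hand the specimen to
FrobeniusClosing (¬BoundedMilnor evidence) and WildCones. (ii) ¬Steer / ¬PatchingRelPerfect /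
¬DescentPerfectToAll proved ⇒ the whole LU family dies at that node; close with
FrobeniusClosing/WildCones/ShadowGame. (iii) IsolatedForcedTermination proved elsewhere (e.g.
ConeExit ∧ NarrowRunsDie ∧ ClassicalRegimes of WildCones) moots rank 2 as a route driver (keep it as
the quantitative bound); TorsorLUPerfect / LuAlphaPTorsor (stmt-0641) proved elsewhere moots ranks
2–6 (close `superseded --by`).

NOT DECOMPOSED YET. The two halves NoExcess / Conservation of § Two-layer plan (layer-2 children of
IsolatedJacobianDrop, to be cut by the lead prover: the Chern route needs intersection numbers
absent from Mathlib, so the expected Lean proof is a DIRECT colength count through the chart map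
κ[[u]] → κ[[u']] with the Euler identity supplying the extra u_i-order); the log/boundary refinement
Δ_(n,r)(p) = p^r(p−1)^(n−r) of the card (proved vacuous here for p ≥ 3: the log zero scheme on the
new exceptional divisor is always positive-dimensional because the Euler syzygy of a degree-p form
is not Koszul; finite and exact for p = 2); the unforced regime (Steer, deliberately rule-free as in
FrobeniusClosing); explicit chain-length bound #steps ≤ 1 + (μ₀ − p(p−1)^(n−1))/Δ_n(p) (a corollary,
not an item).

CHEAPEST FALSIFIER. The census itself (lens Stage 1, RUN): exact simulation of the typed dynamics
over GF(p), GF(p²) — cleaned polynomial states, all charts, all translations, successors kept iff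
cleaned order ≥ p and the Jacobian colength STABILISES (μ_N = μ_(N+1) ⇒ μ = μ_N: no truncation
artefact), exactness degree tracked. Local pre-census (dual/, DUAL-NUMERICS.md §1): 415 certified
transitions over GF(2),GF(4),GF(3),GF(9),GF(5),GF(25) in (p,n) ∈
{(2,2),(2,3),(2,4),(3,2),(3,3),(3,4),(5,2)}: 0 violations, slack = 0 (the exact constant) in 93
cases, constants Δ_2(2)=1, Δ_3(2)=2, Δ_2(3)=5, Δ_3(3)=11, Δ_4(3)=21, Δ_2(5)=19 all attained. Kit job
j022217 extends to (5,3),(9,3),(9,4),(7,2),(2,5). A refuter re-runs dual/job (other seeds, GF(p³),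
catalogued specimens); the first negative slack is news either way.

NUMBERS. Δ_n(p) = ((p−1)^n(p+1) − (−1)^n)/p: Δ_1(p) = p; Δ_2(p) = p² − p − 1 (2→1, 3→5, 5→19, 7→41);
Δ_3(2) = 2, Δ_3(3) = 11, Δ_3(5) = 77; Δ_4(2) = 1, Δ_4(3) = 21, Δ_4(5) = 307; Δ_5(2) = 2, Δ_5(3) =
43. Lower bound at successor-bearing states: μ ≥ p(p−1)^(n−1) = Δ_n(p) + ((p−1)^(n−1) + (−1)^n)/p
(orders (2,…,2,≥3) of the partials in coordinates adapted to the additive direction). Log decrement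
of the card Δ_(n,r)(p) = p^r(p−1)^(n−r) and the n = 2 saturation correction j² + j(2p + r − 2) both
reproduced exactly by the census (12→3, 15→6 at p = 3, j = 1).

DEFINITION REQUESTS. None: every item is typed in the let-bound coefficient calculus of
FrobeniusClosing (clean / bl / dv / tr / step / run / ser / pd / jac / Isol / MultP / mu), shared
verbatim so that the gate deduplicates the five shared items.

Novelty: Searches (2026-08-17): `lit search` ×6 (searchd unavailable, rc reset — recorded), `lit vsearch` ×4
("Milnor number of the strict transform after blowing up a point…", "superisolated … (d−1)^3 plus
sum of Milnor numbers…", "sum of the Milnor numbers of the singular points of the foliation after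
blowing up…": hits Hartshorne1977 p.458, Eisenbud–Harris 3264 pp.77/390/459, Kollar2007 p.94,
Casas-Alvero2000 — all char-0 / curve budgets), `lit galaxy search "superisolated" / "Tjurina
number" / "Milnor number blowing up superisolated" --star all` (Artal-Bartolo et al. Cremona/Zariski
pairs; no char-p blow-up budget), `lit read arxiv:2602.06553` pp.1–5,18–20 (Bérczi: ML-evolved
delayed rankers with Jacobian-density features f_22/f_23 — no conservation law), the 87 idea cards
(chern-budget, cleaned-frobenius-colength-tower, arithmetic-thickening-tjurina-superadditive,
shannon-anatomy-eternal-runs read), the 29 route files, negatives (empty), 42 barrier files (index).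
In-project nearest: card chern-budget (global Chern number, log version, decrement Δ_(n,r); its
critic's vacuity flag is explained and repaired here) and FrobeniusClosing's BoundedMilnor (μ as
hypothesis).
Nearest prior art found: doi:10.1007/bfb0062814 (van den Essen 1979, Milnor-number budget for
reduction of A dy = B dx: the n = 2, twist-ν conservation law) and doi:10.2307/2373435 (Seidenberg
1968); doi:10.1070/im1976v010n06abeh001833 / doi:10.1007/bf02699128 (zeros of twisted forms counted
by c_2, surfaces, char p);  [refs: 10.1007/bfb0062814, 10.2307/2373435, 10.1070/im1976v010n06abeh001833, 10.1007/bf02699128, 2602.06553, arxiv:2602.06553, doi:10.1007/bfb0062814, doi:10.2307/2373435, doi:10.1070/im1976v010n06abeh001833, doi:10.1007/bf02699128, Hartshorne1977, Kollar2007]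

Barriers (technique_class: chern-budget jacobian-colength-lyapunov point-blowup-sequence): - technique_class: chern-budget, jacobian-colength-lyapunov, point-blowup-sequence
- Literature.Barriers.ResolutionOfSingularities.hauserPerlega_mohProofBoundFails: evaded — the
budget is NOT a residual order / shade / order of a coefficient ideal and needs no eventual bound on
it: μ = τ/p is the Jacobian colength of the atom, an analytic invariant with a closed-form
decrement; Hauser–Perlega's cycles (HauserPerlega2019: residual order → ∞ along z^(p^e)+F, e ≥ 3,
point centres NOT forced, dF with divisorial zeros) live outside the height-one ISOLATED regime the
crux quantifies over — there the route is silent by design and Steer (shared) carries the unforced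
regime.
- Literature.Barriers.ResolutionOfSingularities.Hauser2003_kangarooShadeIncrease: evaded by
intrinsicness — no hypersurface of weak maximal contact is chosen, nothing is re-maximised after a
translation; a kangaroo re-coordinatisation cannot change μ (KangarooShadeIncreaseNarrow narrows the
barrier to the uncorrected re-maximised shade, which is not used).
- Literature.Barriers.ResolutionOfSingularities.Narasimhan1983_noSmoothHypersurfaceThroughTopLocus:
not met — no maximal contact; centres are the forced closed points of the isolated regime.
- Literature.Barriers.ResolutionOfSingularities.DirectrixSmallCharacteristicNarrow: not met — no
directrix / Hilbert–Samuel strategy; the additive-direction space of the tangent form enters only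
the no-excess lemma, at closed points over perfect κ (hironakaQuadric_directrixZ

History (route lifecycle, newest last):
- 2026-08-25T13:26:32Z · DORMANT — reconciler: no traction for 7.7 d (last activity item-evidence-added at 2026-08-17T19:15:50Z); parked, not closed — `ledger route dormant route-ResolutionOfSing (operator:999:1890461)
- 2026-08-26T14:55:43Z · REACTIVATED — director-resolution L0 tranche seated (D-0089 rescue); operator clears dormancy (operator:999:3559850)
- 2026-08-26T15:40:48Z · DORMANT — reconciler: no traction for 8.8 d (last activity item-evidence-added at 2026-08-17T19:15:50Z); parked, not closed — `ledger route dormant route-ResolutionOfSing (operator:999:2476586)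
- 2026-08-26T16:25:20Z · REACTIVATED — dormant cleared (operator:999:1060920)

sub-problem: ResolutionOfSingularities · status: open · opened planner-plan-lens3-ResolutionOfSingularities-dual-0 2026-08-17T03:08:59Z · rev 1 · ledger route-ResolutionOfSingularities-JacobianBudget
GENERATED by the gate from the ledger (D-0016/17). Provers cite these decls: `theorem foo : Summit.ResolutionOfSingularities.ResolutionOfSingularities.Theses.JacobianBudget.<Decl> := …` in Summits/ResolutionOfSingularities/ResolutionOfSingularities/Theorems/<Name>.lean.
-/

namespace Summit.ResolutionOfSingularities.ResolutionOfSingularities.Theses.JacobianBudget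

open scoped BigOperators Topology Manifold Classical MeasureTheory ProbabilityTheory Matrix InnerProductSpace ComplexConjugate ContinuousMap
open Filter Set Function TopologicalSpace MeasureTheory

attribute [summit_statement] _root_.ResolutionOfSingularities

/-- item stmt-ResolutionOfSingularities-16343 · target · rank 0 · closed · proved by Summit.ResolutionOfSingularities.ResolutionOfSingularities.Theorems.WildCones.IsolatedForcedTermination_proof (prover) · by planner
why it might fail: an isolated forced cycle or a μ-pumping eternal isolated chain (Hauser–Perlega's missing forced examples) refutes it; IsolatedJacobianDrop says neither exists.
sources: arXiv:1802.05010, arXiv:1412.0868, arXiv:1005.4503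
[target] the TARGET (IsoDrop for height-one atoms, all n, all perfect fields): no start series,
chart sequence and translation sequence over a perfect field of char p yields an INFINITE run of the
point-blow-up dynamics all of whose states are isolated of multiplicity p. Derived in `closes` as
ClosingReduction NoPeriodicIsolatedAtom BoundedMilnor; provable directly by anyone with a budget (a
ranking on μ-bounded states) — char 2 looks like a budget regime (spine card toy B: μ drops by a
constant at every forced step, ~290 steps, n = 3,4,5); consumed by Steer. -/
@[route_item "route-ResolutionOfSingularities-JacobianBudget"]
def IsolatedForcedTermination : Prop :=
  ∀ p : ℕ, p.Prime → ∀ n : ℕ, 0 < n → ∀ (κ : Type) [Field κ] [CharP κ p] [PerfectField κ] (c₀ : (Fin n → ℕ) → κ) (i : ℕ → Fin n) (t : ℕ → Fin n → κ), let clean : ((Fin n → ℕ) → κ) → ((Fin n → ℕ) → κ) := fun c A => @ite κ (∀ j, p ∣ A j) (Classical.dec _) 0 (c A); let bl : Fin n → ((Fin n → ℕ) → κ) → ((Fin n → ℕ) → κ) := fun i c B => @ite κ (Finset.sum (Finset.univ.erase i) (fun j => B j) ≤ B i) (Classical.dec _) (c (Function.update B i (B i - Finset.sum (Finset.univ.erase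 i) (fun j => B j)))) 0; let ord : ((Fin n → ℕ) → κ) → ℕ := fun c => sInf {m : ℕ | ∃ A, c A ≠ 0 ∧ m = Finset.sum Finset.univ (fun j => A j)}; let dv : Fin n → ℕ → ((Fin n → ℕ) → κ) → ((Fin n → ℕ) → κ) := fun i s c B => c (Function.update B i (B i + s)); let tr : Fin n → (Fin n → κ) → ℕ → ((Fin n → ℕ) → κ) → ((Fin n → ℕ) → κ) := fun i τ s c B => Finset.sum (Fintype.piFinset (fun _ : Fin n => Finset.range (B i + s + 1))) (fun D => @ite κ (D i = 0) (Classical.dec _) (c (B + D) * Finset.prod (Finset.univ.erase i) (fun j => ((Nat.choose (B j + D j) (B j) : ℕ) : κ) * τ j ^ (D j))) 0); let step : Fin n → (Fin n → κ) → ((Fin n → ℕ) → κ) → ((Fin n → ℕ) → κ) := fun i τ c => clean (tr i τ (@ite ℕ (p ≤ ord (clean c)) (Classical.dec _) p 0) (dv i (@ite ℕ (p ≤ ord (clean c)) (Classical.dec _) p 0) (bl i (clean c)))); let run : ((Fin n → ℕ) → κ) → (ℕ → Fin n) → (ℕ → Fin n → κ) → ℕ → ((Fin n → ℕ) → κ)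 := fun c₀ i t m => @Nat.rec (fun _ => (Fin n → ℕ) → κ) c₀ (fun m c => step (i m) (t m) c) m; let ser : ((Fin n → ℕ) → κ) → MvPowerSeries (Fin n) κ := fun c => show MvPowerSeries (Fin n) κ from fun A : Fin n →₀ ℕ => clean c ⇑A; let pd : Fin n → MvPowerSeries (Fin n) κ → MvPowerSeries (Fin n) κ := fun i f => show MvPowerSeries (Fin n) κ from fun A : Fin n →₀ ℕ => ((A i + 1 : ℕ) : κ) * f (A + Finsupp.single i 1); let jac : ((Fin n → ℕ) → κ) → Ideal (MvPowerSeries (Fin n) κ) := fun c => Ideal.span (Set.range (fun i => pd i (ser c))); let Isol : ((Fin n → ℕ) → κ) → Prop := fun c => Module.Finite κ (MvPowerSeries (Fin n) κ ⧸ jac c); let MultP : ((Fin n → ℕ) → κ) → Prop := fun c => (∃ A, clean c A ≠ 0) ∧ ∀ A, clean c A ≠ 0 → p ≤ Finset.sum Finset.univ (fun j => A j); ¬ (∀ m, Isol (run c₀ i t m) ∧ MultP (run c₀ i t m))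

-- `IsolatedForcedTermination` holds: proved by `Summit.ResolutionOfSingularities.ResolutionOfSingularities.Theorems.WildCones.IsolatedForcedTermination_proof` (its module imports this route file, so no `_holds` link can be stated here).

/-- item stmt-ResolutionOfSingularities-18946 · crux · rank 2 · open · by planner
why it might fail: the sharp constant may be off where the census is thin (p = 2, n even: observed minimum drop 2 > Δ_4(2) = 1 is fine, an OVERcount anywhere is fatal); the no-excess step uses Krull at the cone vertex and G(e_n) = 0 — one certified transition with μ_Q + Δ_n(p) > μ_P kills it.
sources: doi:10.1007/bfb0062814, doi:10.1070/im1976v010n06abeh001833, arXiv:1802.05010, arXiv:1005.4503, arXiv:2602.06553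
[crux] THE BUDGET (card chern-budget, local face; lens DualFeasible). For every prime p, n ≥ 1,
perfect κ of char p, every start c₀, chart sequence i and translation sequence t: if the states at
stages m and m+1 of the dynamics are both isolated (κ[[u]]/(∂a) finite) of multiplicity p (cleaned
order ≥ p), then μ(stage m+1) + Δ_n(p) ≤ μ(stage m), with μ = finrank κ[[u]]/(∂_1 a,…,∂_n a) of the
cleaned state and Δ_n(p) = ((p−1)^n(p+1) + 1 − 2·((n+1) mod 2))/p. Proof plan: conservation (5) +
no-excess (4) of § Why this line; n = 1 is ord-bookkeeping (drop = p = Δ_1), n = 2 includes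
transitions from cleaned order p+1 (no divisorial zero of the plain form; census: drops 5,6 ≥ Δ_2(3)
= 5). [difficulty: L] -/
@[route_item "route-ResolutionOfSingularities-JacobianBudget", crux]
def IsolatedJacobianDrop : Prop :=
  ∀ p : ℕ, p.Prime → ∀ n : ℕ, 0 < n → ∀ (κ : Type) [Field κ] [CharP κ p] [PerfectField κ] (c₀ : (Fin n → ℕ) → κ) (i : ℕ → Fin n) (t : ℕ → Fin n → κ), let clean : ((Fin n → ℕ) → κ) → ((Fin n → ℕ) → κ) := fun c A => @ite κ (∀ j, p ∣ A j) (Classical.dec _) 0 (c A); let bl : Fin n → ((Fin n → ℕ) → κ) → ((Fin n → ℕ) → κ) := fun i c B => @ite κ (Finset.sum (Finset.univ.erase i) (fun j => B j) ≤ B i) (Classical.dec _) (c (Function.update B i (B i - Finset.sum (Finset.univ.erase i) (fun j => B j)))) 0; let ord : ((Fin n → ℕ) → κ) → ℕ := fun c => sInf {m : ℕ | ∃ A, c A ≠ 0 ∧ m = Finset.sum Finset.univ (fun j => A j)}; let dv : Fin n → ℕ → ((Fin n → ℕ) → κ) → ((Fin n → ℕ) → κ) := fun i s c B => c (Function.update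 B i (B i + s)); let tr : Fin n → (Fin n → κ) → ℕ → ((Fin n → ℕ) → κ) → ((Fin n → ℕ) → κ) := fun i τ s c B => Finset.sum (Fintype.piFinset (fun _ : Fin n => Finset.range (B i + s + 1))) (fun D => @ite κ (D i = 0) (Classical.dec _) (c (B + D) * Finset.prod (Finset.univ.erase i) (fun j => ((Nat.choose (B j + D j) (B j) : ℕ) : κ) * τ j ^ (D j))) 0); let step : Fin n → (Fin n → κ) → ((Fin n → ℕ) → κ) → ((Fin n → ℕ) → κ) := fun i τ c => clean (tr i τ (@ite ℕ (p ≤ ord (clean c)) (Classical.dec _) p 0) (dv i (@ite ℕ (p ≤ ord (clean c)) (Classical.dec _) p 0) (bl i (clean c)))); let run : ((Fin n → ℕ) → κ) → (ℕ → Fin n) → (ℕ → Fin n → κ) → ℕ → ((Fin n → ℕ) → κ) := fun c₀ i t m => @Nat.rec (fun _ => (Fin n → ℕ) → κ) c₀ (fun m c => step (i m) (t m) c) m; let ser : ((Fin n → ℕ) → κ) → MvPowerSeries (Fin n) κ := fun c => show MvPowerSeries (Fin n) κ from fun A : Fin n →₀ ℕ => clean c ⇑A; let pd : Fin n → MvPowerSeries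 (Fin n) κ → MvPowerSeries (Fin n) κ := fun i f => show MvPowerSeries (Fin n) κ from fun A : Fin n →₀ ℕ => ((A i + 1 : ℕ) : κ) * f (A + Finsupp.single i 1); let jac : ((Fin n → ℕ) → κ) → Ideal (MvPowerSeries (Fin n) κ) := fun c => Ideal.span (Set.range (fun i => pd i (ser c))); let Isol : ((Fin n → ℕ) → κ) → Prop := fun c => Module.Finite κ (MvPowerSeries (Fin n) κ ⧸ jac c); let MultP : ((Fin n → ℕ) → κ) → Prop := fun c => (∃ A, clean c A ≠ 0) ∧ ∀ A, clean c A ≠ 0 → p ≤ Finset.sum Finset.univ (fun j => A j); let mu : ((Fin n → ℕ) → κ) → ℕ := fun c => Module.finrank κ (MvPowerSeries (Fin n) κ ⧸ jac c); let Δ : ℕ := ((p - 1) ^ n * (p + 1) + 1 - 2 * ((n + 1) % 2)) / p; ∀ m, Isol (run c₀ i t m) → MultP (run c₀ i t m) → Isol (run c₀ i t (m + 1)) → MultP (run c₀ i t (m + 1)) → mu (run c₀ i t (m + 1)) + Δ ≤ mu (run c₀ i t m)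

/-- item stmt-ResolutionOfSingularities-16345 · crux · rank 4 · open · by planner
why it might fail: the unforced regime may carry the whole difficulty (CossartPiltant2019 Rem 3.2: ω rises under a permissible centre in dim 4; Hauser–Perlega cycles are unforced): then forced termination buys nothing and Steer is LuAlphaPTorsor again.
sources: arXiv:1412.0868, arXiv:1802.05010, CutkoskyMourtada2019, NovacoskiSpivakovsky2014, Temkin2013, Literature.Barriers.ResolutionOfSingularities.DimensionFourFrontier
[crux] STEERING: if no perfect field carries an infinite chain of isolated multiplicity-p infinitely
near points of a height-one atom (IsolatedForcedTermination, the target), then α_p-torsors over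
bases regular at the centre are uniformizable along every valuation over every perfect field (the
body of TorsorLUPerfect, inlined). Content: at NON-isolated (unforced) stages a positive-dimensional
permissible centre through the centre of the valuation exists; choose it (maximal E-permissible
coordinate stratum, CossartPiltant2019-style) and show the run returns to the isolated regime or
drops multiplicity — the dictionary model/valuation ↔ coefficient dynamics is ShadowGame's
WinToTorsorLU (0-dimensional reduction NovacoskiSpivakovsky2014, Cohen coefficient fields over
perfect κ, toroidal endgame Kato1994/Niziol2006). [deps: ClosingReduction] [difficulty:
open-problem] -/
@[route_item "route-ResolutionOfSingularities-JacobianBudget", crux]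
def Steer : Prop :=
  IsolatedForcedTermination → ∀ p : ℕ, p.Prime → ∀ (k K : Type) [Field k] [CharP k p] [PerfectField k] [Field K] [Algebra k K] (O : ValuationSubring K) (A₀ : Subalgebra k K) (h₀ : A₀.toSubring ≤ O.toSubring) (t : K), A₀.FG → t ^ p ∈ A₀ → IsFractionRing (Algebra.adjoin k (insert t (A₀ : Set K))) K → IsRegularLocalRing (Localization.AtPrime (Ideal.comap (Subring.inclusion h₀) (IsLocalRing.maximalIdeal O))) → ∃ (A : Subalgebra k K) (h : A.toSubring ≤ O.toSubring), A₀ ≤ A ∧ t ∈ A ∧ A.FG ∧ IsFractionRing A K ∧ IsRegularLocalRing (Localization.AtPrime (Ideal.comap (Subring.inclusion h) (IsLocalRing.maximalIdeal O)))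

/-- item stmt-ResolutionOfSingularities-16162 · crux · rank 5 · open · by planner
why it might fail: rests on Temkin2013 Thm 1.3.2 (vendored fact with an unproved leaf Temkin2013RelativeCurveSmoothFibre) and on Temkin's model dominating the GIVEN R (relative form); smooth ≠ regular bookkeeping at each tower step.
sources: Temkin2013, arXiv:0804.1554, Literature.AlgebraicGeometry.Resolution.Temkin2013Relative, Literature.Barriers.ResolutionOfSingularities.InseparableBaseChange
[crux] Temkin's inseparable reduction over PERFECT ground fields: for every prime p, LU of
α_p-torsors over bases regular at the centre (TorsorLUPerfect at p) implies relative LU for every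
f.g. K/k, k perfect of char p (Temkin2013 Thm 1.3.2: after a finite purely inseparable L/K an affine
model is uniformized with smooth centre; Frobenius F^n moves it into K (k perfect, so k^{p^n} = k
and the transport is finite); the tower K₀ ⊂ … ⊂ K of degree-p radical steps is climbed by the
torsor crux). Valuative's TorsorToLurel (stmt-10968) is the all-k version. [difficulty: L] -/
@[route_item "route-ResolutionOfSingularities-JacobianBudget", crux]
def TorsorToLurelPerfect : Prop :=
  ∀ p : ℕ, p.Prime → (∀ (k K : Type) [Field k] [CharP k p] [PerfectField k] [Field K] [Algebra k K] (O : ValuationSubring K) (A₀ : Subalgebra k K) (h₀ : A₀.toSubring ≤ O.toSubring) (t : K), A₀.FG → t ^ p ∈ A₀ → IsFractionRing (Algebra.adjoin k (insert t (A₀ : Set K))) K → IsRegularLocalRing (Localization.AtPrime (Ideal.comap (Subring.inclusion h₀) (IsLocalRing.maximalIdeal O))) → ∃ (A : Subalgebra k K) (h : A.toSubring ≤ O.toSubring), A₀ ≤ A ∧ t ∈ A ∧ A.FG ∧ IsFractionRing A K ∧ IsRegularLocalRing (Localization.AtPrime (Ideal.comap (Subring.inclusion h) (IsLocalRing.maximalIdeal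 O)))) → ∀ (k K : Type) [Field k] [CharP k p] [PerfectField k] [Field K] [Algebra k K], (⊤ : IntermediateField k K).FG → ∀ O : ValuationSubring K, (∀ c : k, algebraMap k K c ∈ O) → ∀ R : Subalgebra k K, R.FG → R.toSubring ≤ O.toSubring → ∃ (A : Subalgebra k K) (h : A.toSubring ≤ O.toSubring), R ≤ A ∧ A.FG ∧ IsFractionRing A K ∧ IsRegularLocalRing (Localization.AtPrime (Ideal.comap (Subring.inclusion h) (IsLocalRing.maximalIdeal O)))

/-- item stmt-ResolutionOfSingularities-16161 · crux · rank 6 · open · by planner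
why it might fail: patching LUs into one proper regular model is known only in dim ≤ 3 (Zariski; CossartPiltant2008 Prop 4.9 / Piltant2013 need embedded resolution one dimension down); in dim ≥ 4 no reduction Res ⇐ LU exists even in char 0 (CutkoskyMourtada2019 p.3).
sources: CutkoskyMourtada2019, Temkin2013, CossartPiltant2019, NovacoskiSpivakovsky2014, Literature.Barriers.ResolutionOfSingularities.DimensionFourFrontier
[crux] Zariski patching over PERFECT ground fields: for every prime p, relative local uniformization
(every f.g. R ⊆ O is dominated by a f.g. A ⊆ O with Frac A = K, regular at the centre) for all f.g.
K/k with k perfect of char p implies that every reduced separated scheme of finite type over every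
perfect field of char p has a resolution. Fibrewise identical to Valuative's PatchingRel (stmt-0642)
restricted to perfect k — one patching argument proves both. [difficulty: open-problem] -/
@[route_item "route-ResolutionOfSingularities-JacobianBudget", crux]
def PatchingRelPerfect : Prop :=
  ∀ p : ℕ, p.Prime → (∀ (k K : Type) [Field k] [CharP k p] [PerfectField k] [Field K] [Algebra k K], (⊤ : IntermediateField k K).FG → ∀ O : ValuationSubring K, (∀ c : k, algebraMap k K c ∈ O) → ∀ R : Subalgebra k K, R.FG → R.toSubring ≤ O.toSubring → ∃ (A : Subalgebra k K) (h : A.toSubring ≤ O.toSubring), R ≤ A ∧ A.FG ∧ IsFractionRing A K ∧ IsRegularLocalRing (Localization.AtPrime (Ideal.comap (Subring.inclusion h) (IsLocalRing.maximalIdeal O)))) → ∀ (k : Type) [Field k] [CharP k p] [PerfectField k] (X : AlgebraicGeometry.Scheme.{0}) (f : X ⟶ AlgebraicGeometry.Spec (.of k)), AlgebraicGeometry.IsSeparated f → AlgebraicGeometry.LocallyOfFiniteType f → AlgebraicGeometry.QuasiCompact f → AlgebraicGeometry.IsReduced X → Literature.AlgebraicGeometry.Resolution.Scheme.HasResolution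 X

/-- item stmt-ResolutionOfSingularities-0549 · crux · rank 7 · open · by planner
why it might fail: the only known mechanism spreads X over a finitely generated field of definition and base-changes a resolution over a perfect subfield back; regular is not geometrically regular under inseparable extension (EGA IV 6.7.4), e.g. k = F_p((t)) (Temkin2008 Question 3.3.3 open).
sources: arXiv:math/0703678, Kollar2007, Literature.Barriers.ResolutionOfSingularities.InseparableBaseChange, Literature.Barriers.ResolutionOfSingularities.RegularNotGeometricallyRegular
PerfectToAll: for a prime p, resolution of all reduced separated finite-type schemes over all
PERFECT fields of char p implies ResolutionInChar p (all fields of char p). Expected inputs: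
Neron-Popescu (Stacks 07GC), spreading out, openness of regular locus on excellent schemes;
regularity is not stable under inseparable ground field extension, which is the difficulty. -/
@[route_item "route-ResolutionOfSingularities-JacobianBudget", crux]
def DescentPerfectToAll : Prop :=
  ∀ p : ℕ, p.Prime → (∀ (k : Type) [Field k] [CharP k p] [PerfectField k] (X : AlgebraicGeometry.Scheme.{0}) (f : X ⟶ AlgebraicGeometry.Spec (.of k)), AlgebraicGeometry.IsSeparated f → AlgebraicGeometry.LocallyOfFiniteType f → AlgebraicGeometry.QuasiCompact f → AlgebraicGeometry.IsReduced X → Literature.AlgebraicGeometry.Resolution.Scheme.HasResolution X) → Literature.AlgebraicGeometry.Resolution.ResolutionInChar.{0} p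

/-- item stmt-ResolutionOfSingularities-18947 · support · rank 9 · closed · proved by Summit.ResolutionOfSingularities.ResolutionOfSingularities.Theorems.jacobianDropToTermination_proof @ cb6848f1975b (prover) · by planner
sources: arXiv:1802.05010, doi:10.1007/bfb0062814
[support] WEAK DUALITY (lens crux #2, provable now): IsolatedJacobianDrop →
IsolatedForcedTermination — along an infinite run with all states isolated of multiplicity p the
ℕ-valued μ would drop by Δ_n(p) ≥ 1 at every stage, impossible. Pure order bookkeeping through the
let-bound `run`/`mu` (run (m+1) = step (i m) (t m) (run m) definitionally). [difficulty:
provable-now] -/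
@[route_item "route-ResolutionOfSingularities-JacobianBudget", crux]
def JacobianDropToTermination : Prop :=
  IsolatedJacobianDrop → IsolatedForcedTermination

-- `JacobianDropToTermination` holds: proved by `Summit.ResolutionOfSingularities.ResolutionOfSingularities.Theorems.jacobianDropToTermination_proof` @ cb6848f1975b (its module imports this route file, so no `_holds` link can be stated here).

/-- item stmt-ResolutionOfSingularities-18948 · assembly · rank 1 · closed · proved by Summit.ResolutionOfSingularities.ResolutionOfSingularities.Theorems.JacobianBudget.assembly_proof (prover) · by planner
sources: arXiv:1802.05010, Temkin2013
[assembly] IsolatedJacobianDrop → JacobianDropToTermination → Steer → TorsorToLurelPerfect →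
PatchingRelPerfect → DescentPerfectToAll → the Statement. -/
@[route_item "route-ResolutionOfSingularities-JacobianBudget"]
def Assembly : Prop :=
  IsolatedJacobianDrop → JacobianDropToTermination → Steer → TorsorToLurelPerfect → PatchingRelPerfect → DescentPerfectToAll → _root_.ResolutionOfSingularities

-- `Assembly` holds: proved by `Summit.ResolutionOfSingularities.ResolutionOfSingularities.Theorems.JacobianBudget.assembly_proof` (its module imports this route file, so no `_holds` link can be stated here).

/-! D-0027 §2.1 — DECIDING THEOREM (planner-authored via `route open/edit --closes-file`; by planner-plan-lens3-ResolutionOfSingularities-dual-0 2026-08-17T03:08:59Z):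
its hypotheses are this route's items and its conclusion the sub-problem Statement (glue_lint), and it elaborates with this file. -/

@[closes "route-ResolutionOfSingularities-JacobianBudget"] theorem closes (hA : IsolatedJacobianDrop) (hB : JacobianDropToTermination) (hS : Steer)
    (hT : TorsorToLurelPerfect) (hP : PatchingRelPerfect) (hD : DescentPerfectToAll) : _root_.ResolutionOfSingularities :=
  fun p hp => hD p hp (hP p hp (hT p hp (hS (hB hA) p hp)))

end Summit.ResolutionOfSingularities.ResolutionOfSingularities.Theses.JacobianBudget
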